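import Summits.CriticalPhenomena.Ising3DConformalLimit.Theses.InverseSquareTelemetry

/-!
# Route InverseSquareTelemetry — assembly glue (item stmt-CriticalPhenomena-4501)

`Assembly := InverseSquareLaw → PositiveSolutionAsymptotics → PowerLawFromTelemetry →
TwoPointSpineComplement → Ising3DConformalLimit` (route file
`Summits/CriticalPhenomena/Ising3DConformalLimit/Theses/InverseSquareTelemetry.lean`).

Pure logic: the glue `PowerLawFromTelemetry`, fed the inverse-square telemetry (T)
`InverseSquareLaw` and the lattice Agmon–Murata–Pinchover asymptotics (A)
`PositiveSolutionAsymptotics` (its two hypotheses are these two statements verbatim), yields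
`Δ, c > 0` with `G(x)·|x|₂^{2Δ} → c` along the cofinite filter of `ℤ³`; the complement (C)
`TwoPointSpineComplement` applied to `(Δ, c)` yields `ρ > 0` on `(0,1]` and `S` with `0 < Δ`,
the pointwise scaling limit, non-degeneracy, Möbius covariance and `U₄ ≢ 0`; these are exactly
the clauses of `Ising3DConformalLimit = Literature.Probability.LatticeModels.CritIsing3DConformalLimit`
once repackaged as `⟨ρ, Δ, S, …⟩`. No definitions are introduced and no published fact is used.
-/

namespace Summit.CriticalPhenomena.Ising3DConformalLimit.Theorems

open Summit.CriticalPhenomena.Ising3DConformalLimit.Theses.InverseSquareTelemetry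

/-- **Assembly of route InverseSquareTelemetry** (item stmt-CriticalPhenomena-4501, literally
the route decl `Assembly`): (T) `InverseSquareLaw`, (A) `PositiveSolutionAsymptotics`, the glue
`PowerLawFromTelemetry` and the complement (C) `TwoPointSpineComplement` together imply the
conjunct `Ising3DConformalLimit`. Pure logic: the glue turns (T)+(A) into the rotation-invariant
pure power law `G·|x|₂^{2Δ} → c > 0`, and (C) turns that into the Möbius-covariant,
non-degenerate, non-Gaussian scaling limit with the same `Δ`. [folklore] -/
theorem inverseSquareTelemetry_assembly_proof :
    Summit.CriticalPhenomena.Ising3DConformalLimit.Theses.InverseSquareTelemetry.Assembly := by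
  unfold Assembly
  intro hT hA hGlue hC
  -- (T) + (A) through the glue: the pure power law with exponent 2Δ and amplitude c > 0
  obtain ⟨Δ, c, hc, hlim⟩ := hGlue hT hA
  -- (C): the conjunct with this Δ
  obtain ⟨ρ, S, hρ, hΔ, hscal, hnd, hmoeb, hu4⟩ := hC Δ c hc hlim
  exact ⟨ρ, Δ, S, hρ, hΔ, hscal, hnd, hmoeb, hu4⟩

end Summit.CriticalPhenomena.Ising3DConformalLimit.Theorems
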